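import Literature.NumberTheory.Automorphic.UnitaryLineArchTypes
import Literature.NumberTheory.Automorphic.RelNormOneTorusLevel
import Literature.RepresentationTheory.CompactGroups.AbelianCharacterSeparation
import Literature.NumberTheory.Automorphic.ThetaClassSupply
import HarnessLib

/-!
# Fourier supply on the automorphic quotient `[U(1)] = U(1)(L⁺) \ U(1)(𝔸_{L⁺})` of the unitary line

Topic `NumberTheory/Automorphic`; namespace `Literature.NumberTheory.Automorphic` (+ `UnitaryLineChar`;
`Literature.NumberTheory.Weil1964.ThetaKernelDatum` for the theta corollaries §§ 3–4).

For a CM field `L` with maximal totally real subfield `L⁺` let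
`Q := relNormOneIdeles L⁺ L ⧸ relNormOneRat L⁺ L` be the (compact, abelian) automorphic quotient of the
norm-one torus `U(1)_{L/L⁺}` (`RelNormOneTorus*`), `cl = relNormOneInfToQuot L⁺ L : U(1)(L⁺ ⊗ ℝ) →* Q` the
archimedean torus mapped to the quotient, and `archWeight L m` the character of `U(1)(L⁺ ⊗ ℝ)` of
archimedean type `m : (w ∣ ∞) → ℤ` (`UnitaryLineCharacters`).  Everything below is KERNEL-PROVED
[folklore]; the analytic input is the Pontryagin–van Kampen theorem PROVED in
`RepresentationTheory/CompactGroups/AbelianCharacterSeparation` (characters of a compact abelian group separate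
points ⇒ a nonzero continuous function has a nonzero Fourier coefficient) and its §5 (type forcing by
equivariance).

* § 1 Dictionary of archimedean types (continuing `UnitaryLineArchTypes`: `archWeight_neg`,
  `UnitaryLineChar.HasArchType.inv` are THERE): `archWeight_ne_zero`, `archWeight_inv`, and the two conversions
  between the multiplicative relation `χ (cl t) · archWeight L m t = 1` delivered by type forcing and the predicate
  `HasArchType`: `hasArchType_neg_iff_forall_mul_archWeight` / `hasArchType_iff_forall_mul_archWeight_neg`.
* § 2 **Supply on `[U(1)]`** (`exists_hasArchType_integral_mul_ne_zero`): for any finite right-invariant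
  measure `ν` on `Q` positive on opens (e.g. the Haar probability measure `probHaarRelNormOneQuot`), a NONZERO
  `F ∈ C(Q, ℂ)` with `F (q · cl t) = archWeight L m t · F q` has `∫ F·χ dν ≠ 0` for some continuous unitary
  character `χ` of `Q`, and every such `χ` has archimedean type `-m`.
* § 3 **Theta corollary** (`ThetaKernelDatum.exists_hasArchType_thetaLift_ne_zero`, `…thetaLiftFun…`): for a
  dual-pair theta datum `M` (tree `Weil1964/ThetaKernelDualPair`, `ThetaLift`) whose second member is the
  norm-one torus (`G := relNormOneIdeles L⁺ L`, `Γ := relNormOneRat L⁺ L`), a Schwartz vector `Φ` on which the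
  archimedean torus acts through the type-`m` weight at the level of theta functions
  (`Θ_{s(1, i_∞ t)Φ} = archWeight L m t · Θ_Φ`; implied by `s(1, i_∞ t)·Φ = archWeight L m t • Φ` for a
  theta-linear datum, `theta_eigen_of_act_eigen`) and whose kernel `θ_Φ(ξ₀, ·)` is not identically zero, there
  is a character `χ` of `[U(1)]` OF ARCHIMEDEAN TYPE `m` with nonzero theta lift
  `Θ_Φ(χ)(ξ₀) = ∫ θ_Φ(ξ₀, q) χ(q) dν(q) ≠ 0` — the scalar input `h` of
  `ThetaKernelDatum.exists_thetaClass_ne_zero` (`Automorphic/ThetaClassSupply`).  SIGN: the tree kernel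
  `θ_Φ(xΓU, yΓ) = Θ_Φ(s(x,y)⁻¹)` is evaluated at the inverse, so `θ_Φ(ξ, (i_∞ t) • q) = archWeight L m t⁻¹ ·
  θ_Φ(ξ, q)` (`thetaKer_smul_archTorus`) and the supplied character has type `+m`.
* § 4 **Junction with `Automorphic/ThetaClassSupply`** (`exists_thetaClass_ne_zero_of_archType`): in the
  setting of `exists_thetaClass_ne_zero` (theta-equivariant `j ∈ 𝓙`, class-map datum `D`), the type-`m`
  eigen-relation on the Schwartz vector `j(ι ℓ)`, `Θ_{j(ι ℓ)}(s(1, y)) ≠ 0` for some `y`, a test family `𝓕`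
  containing the type-`m` characters and holomorphy of the restricted theta forms against them give a
  character `χ` of type `m` AND a nonzero class in `thetaClasses D (thetaForms 𝓙 𝓕)` — the character is
  supplied, not assumed.

Everything is stated over the tree's constructed carriers (`relNormOneIdeles`, `relNormOneRat`,
`relNormOneInfUnits`, `relNormOneInfToIdeles`, `archWeight`, `UnitaryLineChar.HasArchType`) and the abstract
theta data of `Weil1964/ThetaKernelDualPair`; no hypothesis records, no new definitions.

## References

* A. Deitmar, S. Echterhoff, *Principles of Harmonic Analysis*, 2nd ed. (2014), Prop. 3.5.2
  [corpus:book:deitmar2014-principles-harmonic-analysis chunk p0117 L16]. [DeitmarEchterhoff2014]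
* P. Fleig, H. P. A. Gustafsson, A. Kleinschmidt, D. Persson, *Eisenstein Series and Automorphic
  Representations* (2018), §12.3 (theta lifts). [FleigEtAl2018]
-/

set_option autoImplicit false

noncomputable section

open _root_.MeasureTheory _root_.Function
open NumberField InfinitePlace
open Literature.RepresentationTheory.CompactGroups

namespace Literature.NumberTheory.Automorphic

/-! ## § 1. Archimedean types: inverses and the multiplicative form -/

section ArchWeight

variable (L : Type) [Field L] [NumberField L] [IsCMField L]

/-- The typed weight never vanishes (it is unitary). [folklore] -/
theorem archWeight_ne_zero (m : InfinitePlace L → ℤ) (y : relNormOneInfUnits (maximalRealSubfield L) L) :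
    archWeight L m y ≠ 0 :=
  norm_ne_zero_iff.mp (by rw [norm_archWeight]; exact one_ne_zero)

/-- `archWeight L (-m) y · archWeight L m y = 1`. [folklore] -/
theorem archWeight_neg_mul (m : InfinitePlace L → ℤ) (y : relNormOneInfUnits (maximalRealSubfield L) L) :
    archWeight L (-m) y * archWeight L m y = 1 := by
  rw [← archWeight_add, neg_add_cancel, archWeight_zero]

/-- `archWeight L m y⁻¹ = archWeight L (-m) y`. [folklore] -/
theorem archWeight_inv (m : InfinitePlace L → ℤ) (y : relNormOneInfUnits (maximalRealSubfield L) L) :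
    archWeight L m y⁻¹ = archWeight L (-m) y := by
  rw [map_inv, archWeight_neg]

end ArchWeight

namespace UnitaryLineChar

variable (L : Type) [Field L] [NumberField L] [IsCMField L]

/-- **Multiplicative form of "type `-m`"**: `χ` has archimedean type `-m` iff
`χ (cl y) · archWeight L m y = 1` for all `y` — the relation delivered by type forcing
(`coe_character_mul_weight_eq_one`) for a weight-`m` equivariant function. [folklore] -/
theorem hasArchType_neg_iff_forall_mul_archWeight (χ : ContinuousMonoidHom
      (relNormOneIdeles (maximalRealSubfield L) L ⧸ relNormOneRat (maximalRealSubfield L) L) Circle)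
    (m : InfinitePlace L → ℤ) :
    HasArchType L χ (-m) ↔ ∀ y : relNormOneInfUnits (maximalRealSubfield L) L,
      ((χ (relNormOneInfToQuot (maximalRealSubfield L) L y) : Circle) : ℂ) * archWeight L m y = 1 := by
  rw [hasArchType_iff]
  refine forall_congr' fun y => ?_
  rw [archWeight_neg]
  constructor
  · intro h
    rw [h, inv_mul_cancel₀ (archWeight_ne_zero L m y)]
  · intro h
    exact eq_inv_of_mul_eq_one_left h

/-- The same read the other way: `χ` has type `m` iff `χ (cl y) · archWeight L (-m) y = 1` for all `y`.
[folklore] -/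
theorem hasArchType_iff_forall_mul_archWeight_neg (χ : ContinuousMonoidHom
      (relNormOneIdeles (maximalRealSubfield L) L ⧸ relNormOneRat (maximalRealSubfield L) L) Circle)
    (m : InfinitePlace L → ℤ) :
    HasArchType L χ m ↔ ∀ y : relNormOneInfUnits (maximalRealSubfield L) L,
      ((χ (relNormOneInfToQuot (maximalRealSubfield L) L y) : Circle) : ℂ) * archWeight L (-m) y = 1 := by
  rw [← hasArchType_neg_iff_forall_mul_archWeight, neg_neg]

end UnitaryLineChar

/-! ## § 2. Fourier supply on `[U(1)]` with the archimedean type forced -/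

section SmulDict

variable (K L : Type) [Field K] [Field L] [NumberField L] [Algebra K L] [FiniteDimensional K L]

/-- The archimedean torus element `i_∞ t ∈ U(1)(𝔸_K)` acting on the automorphic quotient (Mathlib's left
action of the group on its coset space) is right multiplication by `cl t`. [folklore] -/
theorem relNormOneInfToIdeles_smul (t : relNormOneInfUnits K L) (q : relNormOneIdeles K L ⧸ relNormOneRat K L) :
    (relNormOneInfToIdeles K L t) • q = q * relNormOneInfToQuot K L t := by
  induction q using QuotientGroup.induction_on with
  | H y =>
    rw [MulAction.Quotient.smul_mk, smul_eq_mul, relNormOneInfToQuot_apply, ← QuotientGroup.mk_mul,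
      mul_comm]

end SmulDict

section Supply

variable (L : Type) [Field L] [NumberField L] [IsCMField L]

/-- **Supply on `[U(1)]`, type forced.**  `ν` a finite right-invariant measure on
`Q = U(1)(L⁺) \ U(1)(𝔸)` positive on opens; a NONZERO continuous `F` on `Q` with
`F (q · cl t) = archWeight L m t · F q` has a nonzero coefficient `∫ F·χ dν` against some continuous
unitary character `χ` of `Q`, and any such `χ` has archimedean type `-m`
(`exists_character_integral_mul_ne_zero_of_equivariant` + `hasArchType_neg_iff_forall_mul_archWeight`).
[folklore] -/
theorem exists_hasArchType_integral_mul_ne_zero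
    (ν : Measure (relNormOneIdeles (maximalRealSubfield L) L ⧸ relNormOneRat (maximalRealSubfield L) L))
    [IsFiniteMeasure ν] [ν.IsOpenPosMeasure] [ν.IsMulRightInvariant] (m : InfinitePlace L → ℤ)
    (F : C(relNormOneIdeles (maximalRealSubfield L) L ⧸ relNormOneRat (maximalRealSubfield L) L, ℂ))
    (hF : F ≠ 0)
    (heq : ∀ (q : relNormOneIdeles (maximalRealSubfield L) L ⧸ relNormOneRat (maximalRealSubfield L) L)
      (t : relNormOneInfUnits (maximalRealSubfield L) L),
      F (q * relNormOneInfToQuot (maximalRealSubfield L) L t) = archWeight L m t * F q) :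
    ∃ χ : PontryaginDual
        (relNormOneIdeles (maximalRealSubfield L) L ⧸ relNormOneRat (maximalRealSubfield L) L),
      UnitaryLineChar.HasArchType L χ (-m) ∧ ∫ q, F q * ((χ q : Circle) : ℂ) ∂ν ≠ 0 := by
  obtain ⟨χ, hne, htype⟩ := exists_character_integral_mul_ne_zero_of_equivariant ν
    (relNormOneInfToQuot (maximalRealSubfield L) L) (archWeight L m) F hF heq
  exact ⟨χ, (UnitaryLineChar.hasArchType_neg_iff_forall_mul_archWeight L χ m).mpr htype, hne⟩

/-- **Type forcing on `[U(1)]` alone**: if `F (q · cl t) = archWeight L m t · F q`, `ν` is right invariant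
and `∫ F·χ dν ≠ 0`, then `χ` has archimedean type `-m`. [folklore] -/
theorem hasArchType_neg_of_integral_mul_ne_zero
    (ν : Measure (relNormOneIdeles (maximalRealSubfield L) L ⧸ relNormOneRat (maximalRealSubfield L) L))
    [ν.IsMulRightInvariant] (m : InfinitePlace L → ℤ)
    (F : relNormOneIdeles (maximalRealSubfield L) L ⧸ relNormOneRat (maximalRealSubfield L) L → ℂ)
    (heq : ∀ (q : relNormOneIdeles (maximalRealSubfield L) L ⧸ relNormOneRat (maximalRealSubfield L) L)
      (t : relNormOneInfUnits (maximalRealSubfield L) L),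
      F (q * relNormOneInfToQuot (maximalRealSubfield L) L t) = archWeight L m t * F q)
    (χ : PontryaginDual
        (relNormOneIdeles (maximalRealSubfield L) L ⧸ relNormOneRat (maximalRealSubfield L) L))
    (hne : ∫ q, F q * ((χ q : Circle) : ℂ) ∂ν ≠ 0) : UnitaryLineChar.HasArchType L χ (-m) :=
  (UnitaryLineChar.hasArchType_neg_iff_forall_mul_archWeight L χ m).mpr
    (coe_character_mul_weight_eq_one ν (relNormOneInfToQuot (maximalRealSubfield L) L) (archWeight L m) F
      heq χ hne)

end Supply

end Literature.NumberTheory.Automorphic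

/-! ## § 3. The theta corollary: a nonzero theta lift against a character of the forced type -/

namespace Literature.NumberTheory.Weil1964.ThetaKernelDatum

open Literature.NumberTheory.Automorphic Literature.RepresentationTheory.CompactGroups NumberField

variable (L : Type) [Field L] [NumberField L] [IsCMField L]
variable {Mp : Type*} {SX : Type*} [TopologicalSpace Mp] [Group Mp] [TopologicalSpace SX]
variable {GU : Type*} [Group GU] [TopologicalSpace GU] [IsTopologicalGroup GU] {ΓU : Subgroup GU}
variable (M : ThetaKernelDatum Mp SX GU ΓU (relNormOneIdeles (maximalRealSubfield L) L)
  (relNormOneRat (maximalRealSubfield L) L))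

/-- **Equivariance of the theta kernel under the archimedean torus.**  If the archimedean torus acts on
`Φ` through the type-`m` weight at the level of theta functions, `Θ_{s(1, i_∞ t)Φ} = archWeight L m t · Θ_Φ`,
then `θ_Φ(ξ, q · cl t) = archWeight L (-m) t · θ_Φ(ξ, q)` (the kernel is evaluated at `s(x,y)⁻¹`, whence
the sign). [folklore] -/
theorem thetaKer_smul_archTorus (m : InfinitePlace L → ℤ) {Φ : SX}
    (hΦ : ∀ (t : relNormOneInfUnits (maximalRealSubfield L) L) (S : Mp),
      M.W.theta (M.W.act (M.s (1, relNormOneInfToIdeles (maximalRealSubfield L) L t)) Φ) S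
        = archWeight L m t * M.W.theta Φ S)
    (ξ : GU ⧸ ΓU) (q : relNormOneIdeles (maximalRealSubfield L) L ⧸ relNormOneRat (maximalRealSubfield L) L)
    (t : relNormOneInfUnits (maximalRealSubfield L) L) :
    M.thetaKer Φ (ξ, q * relNormOneInfToQuot (maximalRealSubfield L) L t)
      = archWeight L (-m) t * M.thetaKer Φ (ξ, q) := by
  rw [← relNormOneInfToIdeles_smul, thetaKer_smul_right, ← map_inv, ← archWeight_inv]
  exact M.thetaKer_of_theta_eq_mul (hΦ t⁻¹) (ξ, q)

omit [IsTopologicalGroup GU] in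
/-- The eigen-relation ON SCHWARTZ VECTORS, `s(1, i_∞ t)·Φ = archWeight L m t • Φ` (the archimedean torus
acts on `Φ` through the weight of type `m`), implies the eigen-relation on theta functions used below, for
a theta-linear datum (`WeilThetaDatum.ThetaLinear`). [folklore] -/
theorem theta_eigen_of_act_eigen [AddCommGroup SX] [Module ℂ SX] (hlin : M.W.ThetaLinear)
    (m : InfinitePlace L → ℤ) {Φ : SX}
    (hΦ : ∀ t : relNormOneInfUnits (maximalRealSubfield L) L,
      M.W.act (M.s (1, relNormOneInfToIdeles (maximalRealSubfield L) L t)) Φ = archWeight L m t • Φ)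
    (t : relNormOneInfUnits (maximalRealSubfield L) L) (S : Mp) :
    M.W.theta (M.W.act (M.s (1, relNormOneInfToIdeles (maximalRealSubfield L) L t)) Φ) S
      = archWeight L m t * M.W.theta Φ S := by
  rw [hΦ, hlin.map_smul]

variable [CompactSpace (GU ⧸ ΓU)]
  (ν : Measure (relNormOneIdeles (maximalRealSubfield L) L ⧸ relNormOneRat (maximalRealSubfield L) L))
  [IsFiniteMeasure ν] [ν.IsOpenPosMeasure] [ν.IsMulRightInvariant]

/-- **Supply of a nonzero theta lift against a character of the forced archimedean type.**  `M` a dual-pair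
theta datum whose second member is the norm-one torus `U(1)_{L/L⁺}(𝔸)` with its rational points, `ν` a finite
right-invariant measure on `[U(1)]` positive on opens, `Φ` a Schwartz vector on which the archimedean torus
acts through the weight of type `m` (on theta functions), and `θ_Φ(ξ₀, ·) ≢ 0`.  Then some continuous unitary
character `χ` of `[U(1)]` OF ARCHIMEDEAN TYPE `m` has `Θ_Φ(χ)(ξ₀) = ∫ θ_Φ(ξ₀, q) χ(q) dν(q) ≠ 0`.
(Fourier supply `exists_hasArchType_integral_mul_ne_zero` applied to `q ↦ θ_Φ(ξ₀, q)`, of weight `-m` by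
`thetaKer_smul_archTorus`; the lift is `thetaLift_apply`.) [folklore] -/
theorem exists_hasArchType_thetaLift_ne_zero (m : InfinitePlace L → ℤ) {Φ : SX}
    (hΦ : ∀ (t : relNormOneInfUnits (maximalRealSubfield L) L) (S : Mp),
      M.W.theta (M.W.act (M.s (1, relNormOneInfToIdeles (maximalRealSubfield L) L t)) Φ) S
        = archWeight L m t * M.W.theta Φ S)
    {ξ₀ : GU ⧸ ΓU}
    (hne : ∃ q : relNormOneIdeles (maximalRealSubfield L) L ⧸ relNormOneRat (maximalRealSubfield L) L,
      M.thetaKer Φ (ξ₀, q) ≠ 0) :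
    ∃ χ : PontryaginDual
        (relNormOneIdeles (maximalRealSubfield L) L ⧸ relNormOneRat (maximalRealSubfield L) L),
      UnitaryLineChar.HasArchType L χ m ∧ M.thetaLift ν Φ (charCM χ) ξ₀ ≠ 0 := by
  let F : C(relNormOneIdeles (maximalRealSubfield L) L ⧸ relNormOneRat (maximalRealSubfield L) L, ℂ) :=
    (M.thetaKer Φ).curry ξ₀
  have hF : ∀ q, F q = M.thetaKer Φ (ξ₀, q) := fun q => rfl
  have hF0 : F ≠ 0 := by
    obtain ⟨q, hq⟩ := hne
    intro h
    exact hq (by rw [← hF q, h, ContinuousMap.zero_apply])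
  have heq : ∀ q t, F (q * relNormOneInfToQuot (maximalRealSubfield L) L t) = archWeight L (-m) t * F q :=
    fun q t => by rw [hF, hF, M.thetaKer_smul_archTorus L m hΦ]
  obtain ⟨χ, hχ, hint⟩ := exists_hasArchType_integral_mul_ne_zero L ν (-m) F hF0 heq
  refine ⟨χ, (neg_neg m) ▸ hχ, ?_⟩
  rw [thetaLift_apply]
  simpa only [hF, charCM_apply] using hint

/-- The same read on the group `GU` (`thetaLiftFun`, the convention of `Automorphic.weightForms`): with
`θ_Φ(g₀⁻¹ ΓU, ·) ≢ 0` one gets `χ` of type `m` with `Θ̃_Φ(χ)(g₀) ≠ 0` — literally the hypothesis `h` of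
`ThetaKernelDatum.exists_thetaClass_ne_zero` for `f := charCM χ`. [folklore] -/
theorem exists_hasArchType_thetaLiftFun_ne_zero (m : InfinitePlace L → ℤ) {Φ : SX}
    (hΦ : ∀ (t : relNormOneInfUnits (maximalRealSubfield L) L) (S : Mp),
      M.W.theta (M.W.act (M.s (1, relNormOneInfToIdeles (maximalRealSubfield L) L t)) Φ) S
        = archWeight L m t * M.W.theta Φ S)
    {g₀ : GU}
    (hne : ∃ q : relNormOneIdeles (maximalRealSubfield L) L ⧸ relNormOneRat (maximalRealSubfield L) L,
      M.thetaKer Φ (QuotientGroup.mk g₀⁻¹, q) ≠ 0) :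
    ∃ χ : PontryaginDual
        (relNormOneIdeles (maximalRealSubfield L) L ⧸ relNormOneRat (maximalRealSubfield L) L),
      UnitaryLineChar.HasArchType L χ m ∧ M.thetaLiftFun ν Φ (charCM χ) g₀ ≠ 0 := by
  simpa only [thetaLiftFun_apply] using M.exists_hasArchType_thetaLift_ne_zero L ν m hΦ hne

/-- **At the base point** `g₀ = 1` (PerL's supply is used at `g₀ = 1` only): if the theta function of `Φ`
does not vanish identically along `s(1 × U(1)(𝔸))` (`Θ_Φ(s(1, y)) ≠ 0` for some `y`, i.e. `θ_Φ(1·ΓU, ·) ≢ 0`)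
and the archimedean torus acts on `Φ` through the type-`m` weight, then some `χ` of type `m` has
`Θ̃_Φ(χ)(1) ≠ 0`. [folklore] -/
theorem exists_hasArchType_thetaLiftFun_one_ne_zero (m : InfinitePlace L → ℤ) {Φ : SX}
    (hΦ : ∀ (t : relNormOneInfUnits (maximalRealSubfield L) L) (S : Mp),
      M.W.theta (M.W.act (M.s (1, relNormOneInfToIdeles (maximalRealSubfield L) L t)) Φ) S
        = archWeight L m t * M.W.theta Φ S)
    (hne : ∃ y : relNormOneIdeles (maximalRealSubfield L) L, M.W.theta Φ (M.s (1, y)) ≠ 0) :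
    ∃ χ : PontryaginDual
        (relNormOneIdeles (maximalRealSubfield L) L ⧸ relNormOneRat (maximalRealSubfield L) L),
      UnitaryLineChar.HasArchType L χ m ∧ M.thetaLiftFun ν Φ (charCM χ) 1 ≠ 0 := by
  refine M.exists_hasArchType_thetaLiftFun_ne_zero L ν m hΦ ?_
  obtain ⟨y, hy⟩ := hne
  refine ⟨QuotientGroup.mk y⁻¹, ?_⟩
  rwa [inv_one, thetaKer_mk, Prod.inv_mk, inv_one, inv_inv]

/-! ## § 4. Junction with `ThetaClassSupply`: a nonzero theta CLASS from the type-`m` eigen-relation -/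

section Junction

variable [AddCommGroup SX] [Module ℂ SX] (hlin : M.W.ThetaLinear)
variable {Kc : Type*} [Group Kc] (κ : Kc →* GU)
variable {E : Type*} [AddCommGroup E] [Module ℂ E] (σ : Representation ℂ Kc E)
variable {W : Type*} [AddCommGroup W] [Module ℂ W] [Module.IsReflexive ℂ W] {τ : Representation ℂ Kc W}
variable (ι : Module.Dual ℂ W →ₗ[ℂ] E) (hι : ∀ (k : Kc) (ℓ : Module.Dual ℂ W), ι (τ.dual k ℓ) = σ k (ι ℓ))
variable {G₁ : Type*} [Group G₁] {K₁ : Type*} [Group K₁] (ιinf : G₁ →* GU) {Δ : Subgroup G₁}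
  {κ₁ : K₁ →* G₁} {τ₁ : Representation ℂ K₁ W} {hΔ : WeightForms.IsLevelCorrected ΓU κ τ ιinf Δ}
  {η₁ : K₁ →* Kc} {hη : WeightForms.IsWeightMatched κ τ ιinf κ₁ τ₁ η₁}
  {H : Type*} [AddCommGroup H] [Module ℂ H]

/-- **W7a ∘ W6b-2 (tree junction).**  In the setting of `ThetaKernelDatum.exists_thetaClass_ne_zero`
(`Automorphic/ThetaClassSupply`) with second member the norm-one torus: a theta-equivariant `j ∈ 𝓙`, a vector
`ℓ`, the type-`m` eigen-relation `s(1, i_∞ t)·j(ι ℓ) = archWeight L m t • j(ι ℓ)` ON THE SCHWARTZ VECTOR, the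
non-vanishing `Θ_{j(ι ℓ)}(s(1, y)) ≠ 0` for some `y ∈ U(1)(𝔸)`, a test family `𝓕` containing the characters
`charCM χ` of type `m`, and holomorphy of the restricted theta forms against those characters, give a NONZERO
class in `thetaClasses D (thetaForms 𝓙 𝓕)` — the character is SUPPLIED (by
`exists_hasArchType_thetaLiftFun_one_ne_zero`), not assumed. [folklore] -/
theorem exists_thetaClass_ne_zero_of_archType (D : WeightForms.ClassMapDatum ιinf hΔ hη H)
    {𝓙 : Set {j : E →ₗ[ℂ] SX // M.IsThetaEquivariant κ σ j}}
    {𝓕 : Set C(relNormOneIdeles (maximalRealSubfield L) L ⧸ relNormOneRat (maximalRealSubfield L) L, ℂ)}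
    {j : {j : E →ₗ[ℂ] SX // M.IsThetaEquivariant κ σ j}} (hj : j ∈ 𝓙) (m : InfinitePlace L → ℤ)
    {ℓ : Module.Dual ℂ W}
    (hΦ : ∀ t : relNormOneInfUnits (maximalRealSubfield L) L,
      M.W.act (M.s (1, relNormOneInfToIdeles (maximalRealSubfield L) L t)) (j.1 (ι ℓ))
        = archWeight L m t • j.1 (ι ℓ))
    (hne : ∃ y : relNormOneIdeles (maximalRealSubfield L) L, M.W.theta (j.1 (ι ℓ)) (M.s (1, y)) ≠ 0)
    (h𝓕 : ∀ χ : PontryaginDual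
        (relNormOneIdeles (maximalRealSubfield L) L ⧸ relNormOneRat (maximalRealSubfield L) L),
      UnitaryLineChar.HasArchType L χ m → charCM χ ∈ 𝓕)
    (hHol : ∀ χ : PontryaginDual
        (relNormOneIdeles (maximalRealSubfield L) L ⧸ relNormOneRat (maximalRealSubfield L) L),
      UnitaryLineChar.HasArchType L χ m →
        WeightForms.restrictHom ιinf hΔ hη (M.thetaForm ν hlin κ j.1 j.2 ι hι (charCM χ)) ∈ D.Hol) :
    ∃ χ : PontryaginDual
        (relNormOneIdeles (maximalRealSubfield L) L ⧸ relNormOneRat (maximalRealSubfield L) L),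
      UnitaryLineChar.HasArchType L χ m ∧
        ∃ c ∈ WeightForms.thetaClasses ιinf D (M.thetaForms ν hlin κ σ ι hι 𝓙 𝓕), c ≠ 0 := by
  obtain ⟨χ, hχ, h1⟩ := M.exists_hasArchType_thetaLiftFun_one_ne_zero L ν m
    (M.theta_eigen_of_act_eigen L hlin m hΦ) hne
  have h1' : M.thetaLiftFun ν (j.1 (ι ℓ)) (charCM χ) (ιinf 1) ≠ 0 := by rwa [map_one]
  exact ⟨χ, hχ, M.exists_thetaClass_ne_zero ν hlin κ σ ι hι ιinf D hj (h𝓕 χ hχ) h1' (hHol χ hχ)⟩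

end Junction

end Literature.NumberTheory.Weil1964.ThetaKernelDatum

end
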